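import Summits.AtomisticToContinuum.BoseEinsteinCondensation.Theses.BECCellInformation

/-!
# AtomisticToContinuum / BoseEinsteinCondensation — route `BECCellInformation`, assembly

Settles the assembly item `stmt-AtomisticToContinuum-13447` of route
`route-AtomisticToContinuum-BECCellInformation`: the implication
`CellInformationBound → OneBodyEntropyBound → GroundStateRigidity → CoarseChainRule →
EnergyPerParticleBound → TwoScaleReduction → EntropicZeroMode → NonnegNearMinimiser →
OccupationStability → ZeroModeTransfer → BoseEinsteinCondensation`.

The hypotheses of `Assembly` are, verbatim and in the same order, those of the route's deciding
theorem `closes`, so the assembly is that theorem curried. The composition, spelled out: the two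
cruxes `CellInformationBound` (coarse mutual information) and `OneBodyEntropyBound` (one-body
profile entropy) give the coarse conditional entropy bound by `CoarseChainRule`; with
`EnergyPerParticleBound` the cube log-Sobolev step `TwoScaleReduction` turns it into the target
`CondEntropyBound`; `EntropicZeroMode` (Rényi-½ identity + Jensen) turns that into macroscopic
zero-mode occupation for non-negative near-minimisers; `ZeroModeTransfer` (fed with
`EnergyPerParticleBound`, `NonnegNearMinimiser`, `GroundStateRigidity`, `OccupationStability`)
transfers it to all near-minimisers, which is verbatim the hypothesis `X_B1` of the proved frame
theorem `AtomisticToContinuum.BECInfraredBound.bec_of_zeroMode`, whose conclusion is the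
sub-problem statement. Pure logic; no analytic content lives here.
-/

namespace Summit.AtomisticToContinuum.BoseEinsteinCondensation.Theorems

/-- Settles `stmt-AtomisticToContinuum-13447` (exact signature): the assembly of route
`BECCellInformation`, i.e. its ten items imply the sub-problem statement
`BoseEinsteinCondensation`. Proof: `bec_of_zeroMode` applied to the zero-mode bound
`hZ hE hNN hR hO (hJ (hT hE (hCR hA hB)))` — literally the route's deciding theorem `closes`,
curried. [folklore] -/
theorem becCellInformation_assembly_proof :
    Summit.AtomisticToContinuum.BoseEinsteinCondensation.Theses.BECCellInformation.Assembly := by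
  unfold Theses.BECCellInformation.Assembly
  intro hA hB hR hCR hE hT hJ hNN hO hZ
  exact Theses.BECCellInformation.closes hA hB hR hCR hE hT hJ hNN hO hZ

end Summit.AtomisticToContinuum.BoseEinsteinCondensation.Theorems
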